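import Summits.CriticalPhenomena.PercolationContinuityZ3.Theorems.PercNearOneGluingNoHeavyRsw3InvasionGreedy
import HarnessLib

/-!
# RSW3 lane (P1, gen 33): INVASION PERCOLATION — the BLOCKED ABSORPTION PRINCIPLE for the stopped invasion
# (Newman–Tassion–Wu 2017, §4.1, the "observation" used in the proof of Lemma 4.1; every locally finite graph, every label field)

builds on p205010 (kernel theorem, internal audit signed; external expert review pending) — NOT used in this file.

Cell `prim-rsw3`, prover seat `prim-rsw3-p1` (gen 33), sequel scoping memo `run/shared/lean/prim/rsw3/SEQUEL-MSF.md` §3 (R0),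
file F4.  Support file (`--supports stmt-CriticalPhenomena-4575`); no definitions, no named facts, no sorries.  Notation (p2's files
`…Rsw3InvasionGreedy`, `…Rsw3InvasionLocality`): `I_n = invasion G U o n` the invaded region after `n` steps, `x_n = acceptedLabel … n`,
`η_y = configOfLabels y U G`, `C_y(v) = openCluster η_y v`, `n_Λ = exitIndex G U o Λ` the break-out time of a finite set `Λ` (the first
`n` with `I_n ⊄ Λ`); NTW's STOPPED invasion `𝓘_o^m` "stopped when it first reaches any vertex in `∂B̄_m`" is `I_{n_Λ}` with
`Λ = B̄_{m-1}`.

Newman–Tassion–Wu (arXiv:1512.09107, p. 21, proof of Lemma 4.1): «note that when `D_{2n_i,m_i}` occurs, `𝓘_0^{m_i}` (or `𝓘_x^{m_i}`)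
touching any vertex `v ∈ B̄_{2n_i}(0)` implies it also contains all of `𝓒_{p_c}(v)`».  For the UNSTOPPED invasion this is
Chayes–Chayes–Newman's absorption priority (§3 (ii)); for the invasion STOPPED at its break-out of `Λ` it needs the blocking event
(`D`: no `p_c`-open path from `v` out of `Λ`), and the half-page proof the paper leaves to the reader is the "last outlet" argument
formalised here, for EVERY locally finite graph, label field `U`, level `y` and finite `Λ`:

* `exists_mem_invasion_reachable_of_forall_acceptedLabel_le` — BOUNDED PROPAGATION: if every label accepted at the steps
  `n₀ ≤ j < n` is `≤ y`, every vertex of `I_n` is `y`-joined to a vertex of `I_{n₀}` (time-window form of p2's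
  `exists_reachable_of_forall_acceptedLabel_le`).
* `openCluster_subset_invasion_of_lt_acceptedLabel'` — at an OUTLET step (`x_s > y`) every `y`-cluster of an invaded vertex is
  already invaded (CCN §3 (ii); three lines on the greedy inequality, restated here to keep this file's imports at file I).
* `invasion_eq_of_newDart_eq_none` — if no dart can be absorbed at step `s` the region never changes again.
* **`openCluster_subset_invasion_exitIndex_sub_one`** — THE BLOCKED ABSORPTION PRINCIPLE: if `v ∈ I_{n_Λ}` and `C_y(v) ⊆ Λ`, then
  `C_y(v) ⊆ I_{n_Λ - 1}` — the whole `y`-cluster of `v` is invaded BEFORE the break-out (hence `⊆ I_{n_Λ}`,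
  `openCluster_subset_invasion_exitIndex`; time-`n` form `openCluster_subset_invasion_exitIndex_sub_one_of_le`).
  Proof: let `u*` be the break-out vertex (absorbed at step `n_Λ - 1`, `u* ∉ Λ`).  If no label `> y` was accepted before `n_Λ`,
  bounded propagation joins both `v` and `u*` to the root by `y`-open paths, so `u* ∈ C_y(v) ⊆ Λ`: contradiction.  Otherwise let
  `s < n_Λ` be the LAST outlet; `I_s` is a union of complete `y`-clusters, so if `v ∈ I_s` we are done, and if not, bounded
  propagation from `s + 1` joins `v` and `u*` to the vertex `u_s` absorbed at step `s` (a path into `I_s` would put them inside a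
  complete cluster `⊆ I_s`), so again `u* ∈ C_y(v) ⊆ Λ`: contradiction.
Deterministic, tie-breaking free, no sign condition on `y`, no hypothesis on the root.

References: C. M. Newman, V. Tassion, W. Wu, *Critical percolation and the minimal spanning tree in slabs*, Comm. Pure Appl. Math. 70
(2017), arXiv:1512.09107, §2.3 (the observation) and §4.1 p. 21 [NewmanTassionWu2017]; J. T. Chayes, L. Chayes, C. M. Newman, Comm.
Math. Phys. 101 (1985) 383–407, §3 (ii) [ChayesChayesNewman1985].
-/

noncomputable section

namespace Summit.CriticalPhenomena.PercolationContinuityZ3.Theorems.Rsw3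

open Finset Literature.Probability.Percolation Literature.Probability.Percolation.Invasion

variable {V : Type*} [DecidableEq V] {G : SimpleGraph V} [G.LocallyFinite]

/-! ## Bounded propagation and outlets -/

/-- **Bounded propagation.** If every label accepted at the steps `n₀ ≤ j < n` is `≤ y`, then every vertex of `I_n` is joined to a
vertex of `I_{n₀}` by a `y`-open path of `η_y` (time-window form of CCN §3 (ii) "the entire cluster must be absorbed prior to further
absorption of unoccupied bonds"). [cite: ChayesChayesNewman1985, §3 (ii)] -/
theorem exists_mem_invasion_reachable_of_forall_acceptedLabel_le {U : Sym2 V → ℝ} {o : V} {n₀ n : ℕ} {y : ℝ}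
    (hn : n₀ ≤ n) (h : ∀ j, n₀ ≤ j → j < n → acceptedLabel G U o j ≤ y) {v : V} (hv : v ∈ invasion G U o n) :
    ∃ u ∈ invasion G U o n₀, (openGraph (configOfLabels y U G)).Reachable u v := by
  induction n, hn using Nat.le_induction generalizing v with
  | base => exact ⟨v, hv, SimpleGraph.Reachable.refl v⟩
  | succ n hn ih =>
    have h' : ∀ j, n₀ ≤ j → j < n → acceptedLabel G U o j ≤ y := fun j hj hjn => h j hj (Nat.lt_succ_of_lt hjn)
    rw [invasion_succ] at hv
    cases hd : newDart G U (invasion G U o n) with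
    | none => rw [step_of_eq_none G hd] at hv; exact ih h' hv
    | some a =>
      rw [step_of_eq_some G hd, mem_insert] at hv
      rcases hv with rfl | hv
      · obtain ⟨u, hu, hreach⟩ := ih h' (fst_mem_of_newDart hd)
        have hle : U s(a.1, a.2) ≤ y := by
          rw [← acceptedLabel_of_eq_some G hd]; exact h n hn (Nat.lt_succ_self n)
        exact ⟨u, hu, hreach.trans (openGraph_configOfLabels_adj_of_le (adj_of_newDart hd) hle).reachable⟩
      · exact ih h' hv

/-- At an OUTLET step `s` (accepted label `> y`) every `y`-open cluster of an invaded vertex is already entirely invaded: otherwise the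
cluster leaves `I_s` through a boundary dart of label `≤ y` and the greedy rule would have taken it (CCN's cluster-absorption priority;
restated from p2's file VI to keep the imports of this file minimal). [cite: ChayesChayesNewman1985, §3 (ii)] -/
theorem openCluster_subset_invasion_of_lt_acceptedLabel' {U : Sym2 V → ℝ} {o : V} {s : ℕ} {y : ℝ}
    (hs : y < acceptedLabel G U o s) {u : V} (hu : u ∈ invasion G U o s) :
    openCluster (configOfLabels y U G) u ⊆ ↑(invasion G U o s) := by
  intro w hw
  by_contra hwI
  obtain ⟨b, hb, hadj⟩ := exists_boundaryDart_of_reachable (openGraph_configOfLabels_le y U) hw hu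
    (fun h => hwI (Finset.mem_coe.2 h))
  exact absurd ((acceptedLabel_le_of_mem_boundaryDarts hb).trans (label_le_of_openGraph_configOfLabels_adj hadj))
    (not_le.2 hs)

/-- If no dart can be absorbed at step `s` (no boundary dart), the invaded region never changes again: `I_n = I_s` for all `n ≥ s`.
[cite: ChayesChayesNewman1985, §2 (the model)] -/
theorem invasion_eq_of_newDart_eq_none {U : Sym2 V → ℝ} {o : V} {s : ℕ}
    (hs : newDart G U (invasion G U o s) = none) {n : ℕ} (hn : s ≤ n) : invasion G U o n = invasion G U o s := by
  induction n, hn using Nat.le_induction with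
  | base => rfl
  | succ n hn ih =>
    rw [invasion_succ, ih, step_of_eq_none G hs]

/-! ## The blocked absorption principle -/

/-- **THE BLOCKED ABSORPTION PRINCIPLE (NTW's observation for the stopped invasion).** Let `Λ` be a finite vertex set which the
invasion eventually leaves, `n_Λ` its break-out time, and `v ∈ I_{n_Λ}` an invaded vertex whose `y`-open cluster is BLOCKED inside
`Λ` (`C_y(v) ⊆ Λ` — on the slab this is the event `D`: no `p_c`-open path from `B̄_{2n+1} ∋ v` to `∂B̄_m`).  Then the whole cluster
was invaded before the break-out: `C_y(v) ⊆ I_{n_Λ - 1}`.  («when `D_{2n_i,m_i}` occurs, `𝓘_0^{m_i}` touching any vertex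
`v ∈ B̄_{2n_i}` implies it also contains all of `𝓒_{p_c}(v)`», proved by the last-outlet argument of the module docstring.)
[cite: NewmanTassionWu2017, §4.1 (proof of Lemma 4.1, p. 21)] -/
theorem openCluster_subset_invasion_exitIndex_sub_one {U : Sym2 V → ℝ} {o : V} {Λ : Finset V}
    (hex : ∃ n, ¬ invasion G U o n ⊆ Λ) {y : ℝ} {v : V} (hv : v ∈ invasion G U o (exitIndex G U o Λ))
    (hC : openCluster (configOfLabels y U G) v ⊆ ↑Λ) :
    openCluster (configOfLabels y U G) v ⊆ ↑(invasion G U o (exitIndex G U o Λ - 1)) := by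
  obtain ⟨hnot, hbefore⟩ := exitIndex_spec G hex
  have hvΛ : v ∈ Λ := Finset.mem_coe.1 (hC (mem_openCluster_self _ v))
  -- `n_Λ ≠ 0`: otherwise `I_0 = {o} ⊄ Λ`, so `v = o ∉ Λ`
  obtain ⟨T', hT'⟩ : ∃ T', exitIndex G U o Λ = T' + 1 := by
    rcases Nat.eq_zero_or_eq_succ_pred (exitIndex G U o Λ) with h0 | h1
    · exfalso
      rw [h0, invasion_zero] at hnot hv
      rw [Finset.mem_singleton] at hv
      exact hnot (Finset.singleton_subset_iff.2 (hv ▸ hvΛ))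
    · exact ⟨_, h1⟩
  have hsubT' : invasion G U o T' ⊆ Λ := hbefore T' (by omega)
  rw [hT', Nat.add_sub_cancel]
  rw [hT'] at hnot hv
  -- the break-out dart `a* = (z*, u*)`, `u* ∉ Λ`
  obtain ⟨aT, haT⟩ : ∃ a, newDart G U (invasion G U o T') = some a := by
    cases hd : newDart G U (invasion G U o T') with
    | none => exact absurd (by rw [invasion_succ, step_of_eq_none G hd]; exact hsubT') hnot
    | some a => exact ⟨a, rfl⟩
  have hIT : invasion G U o (T' + 1) = insert aT.2 (invasion G U o T') := invasion_succ_of_newDart haT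
  have huΛ : aT.2 ∉ Λ := by
    intro h
    exact hnot (by rw [hIT]; exact Finset.insert_subset h hsubT')
  have huT : aT.2 ∈ invasion G U o (T' + 1) := by rw [hIT]; exact mem_insert_self _ _
  -- `v` was invaded before the break-out
  have hvT' : v ∈ invasion G U o T' := by
    rw [hIT, mem_insert] at hv
    rcases hv with h | h
    · exact absurd (h ▸ hvΛ) huΛ
    · exact h
  -- `u*` is not in the cluster of `v`
  have hu_not : aT.2 ∉ openCluster (configOfLabels y U G) v := fun h => huΛ (Finset.mem_coe.1 (hC h))
  -- the outlet steps before the break-out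
  set O := (Finset.range (T' + 1)).filter fun j => y < acceptedLabel G U o j with hO
  rcases O.eq_empty_or_nonempty with hOe | hOne
  · -- Case A: no outlet before the break-out: everything invaded by time `T' + 1` is `y`-joined to the root
    exfalso
    have hall : ∀ j, 0 ≤ j → j < T' + 1 → acceptedLabel G U o j ≤ y := by
      intro j _ hj
      by_contra hlt
      have : j ∈ O := Finset.mem_filter.2 ⟨Finset.mem_range.2 hj, not_le.1 hlt⟩
      rw [hOe] at this
      exact Finset.notMem_empty j this
    obtain ⟨p, hp, hpv⟩ := exists_mem_invasion_reachable_of_forall_acceptedLabel_le (Nat.zero_le _) hall hv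
    obtain ⟨q, hq, hqu⟩ := exists_mem_invasion_reachable_of_forall_acceptedLabel_le (Nat.zero_le _) hall huT
    rw [invasion_zero, Finset.mem_singleton] at hp hq
    subst hp; subst hq
    exact hu_not (hpv.symm.trans hqu)
  · -- Case B: let `s` be the last outlet before the break-out
    set s := O.max' hOne with hsdef
    have hsO : s ∈ O := Finset.max'_mem O hOne
    have hs_lt : s < T' + 1 := Finset.mem_range.1 (Finset.mem_filter.1 hsO).1
    have hs_out : y < acceptedLabel G U o s := (Finset.mem_filter.1 hsO).2
    have hafter : ∀ j, s + 1 ≤ j → j < T' + 1 → acceptedLabel G U o j ≤ y := by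
      intro j hj hjT
      by_contra hlt
      have hjO : j ∈ O := Finset.mem_filter.2 ⟨Finset.mem_range.2 hjT, not_le.1 hlt⟩
      have := Finset.le_max' O j hjO
      rw [← hsdef] at this
      omega
    -- complete clusters at the outlet
    have hcomplete : ∀ u ∈ invasion G U o s, openCluster (configOfLabels y U G) u ⊆ ↑(invasion G U o s) :=
      fun u hu => openCluster_subset_invasion_of_lt_acceptedLabel' hs_out hu
    have hsT' : invasion G U o s ⊆ invasion G U o T' := invasion_mono U o (by omega)
    by_cases hvs : v ∈ invasion G U o s
    · -- `v` already invaded at the outlet: its cluster is inside `I_s ⊆ I_{T'}`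
      exact (hcomplete v hvs).trans (Finset.coe_subset.2 hsT')
    · -- `v` invaded after the last outlet: it and the break-out vertex hang off the outlet vertex `u_s`
      exfalso
      -- the dart absorbed at the outlet step
      obtain ⟨aS, haS⟩ : ∃ a, newDart G U (invasion G U o s) = some a := by
        cases hd : newDart G U (invasion G U o s) with
        | none =>
          exfalso
          have := invasion_eq_of_newDart_eq_none hd hs_lt.le
          exact hnot (this ▸ (hsT'.trans hsubT'))
        | some a => exact ⟨a, rfl⟩
      have hIs : invasion G U o (s + 1) = insert aS.2 (invasion G U o s) := invasion_succ_of_newDart haS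
      -- bounded propagation from `s + 1` to the break-out time
      obtain ⟨p, hp, hpv⟩ := exists_mem_invasion_reachable_of_forall_acceptedLabel_le (by omega) hafter hv
      obtain ⟨q, hq, hqu⟩ := exists_mem_invasion_reachable_of_forall_acceptedLabel_le (by omega) hafter huT
      rw [hIs, mem_insert] at hp hq
      -- `p = u_s`: a path from `I_s` would put `v` inside a complete cluster `⊆ I_s`
      have hp' : p = aS.2 := by
        rcases hp with h | h
        · exact h
        · exact absurd (Finset.mem_coe.1 (hcomplete p h hpv)) hvs
      -- `q = u_s`: likewise `u* ∉ I_s ⊆ Λ`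
      have hq' : q = aS.2 := by
        rcases hq with h | h
        · exact h
        · exact absurd (hsubT' (hsT' (Finset.mem_coe.1 (hcomplete q h hqu)))) huΛ
      subst hp'; rw [hq'] at hqu
      exact hu_not (hpv.symm.trans hqu)

/-- The blocked absorption principle, stopped form: under the same hypotheses `C_y(v) ⊆ I_{n_Λ}` (NTW's `𝓘^m ⊇ 𝓒_{p_c}(v)`).
[cite: NewmanTassionWu2017, §4.1 (proof of Lemma 4.1, p. 21)] -/
theorem openCluster_subset_invasion_exitIndex {U : Sym2 V → ℝ} {o : V} {Λ : Finset V}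
    (hex : ∃ n, ¬ invasion G U o n ⊆ Λ) {y : ℝ} {v : V} (hv : v ∈ invasion G U o (exitIndex G U o Λ))
    (hC : openCluster (configOfLabels y U G) v ⊆ ↑Λ) :
    openCluster (configOfLabels y U G) v ⊆ ↑(invasion G U o (exitIndex G U o Λ)) :=
  (openCluster_subset_invasion_exitIndex_sub_one hex hv hC).trans
    (Finset.coe_subset.2 (invasion_mono U o (Nat.sub_le _ _)))

/-- The blocked absorption principle at any time `n ≤ n_Λ`: if `v ∈ I_n` and `C_y(v) ⊆ Λ` then `C_y(v) ⊆ I_{n_Λ - 1}`.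
[cite: NewmanTassionWu2017, §4.1 (proof of Lemma 4.1, p. 21)] -/
theorem openCluster_subset_invasion_exitIndex_sub_one_of_le {U : Sym2 V → ℝ} {o : V} {Λ : Finset V}
    (hex : ∃ n, ¬ invasion G U o n ⊆ Λ) {y : ℝ} {v : V} {n : ℕ} (hn : n ≤ exitIndex G U o Λ)
    (hv : v ∈ invasion G U o n) (hC : openCluster (configOfLabels y U G) v ⊆ ↑Λ) :
    openCluster (configOfLabels y U G) v ⊆ ↑(invasion G U o (exitIndex G U o Λ - 1)) :=
  openCluster_subset_invasion_exitIndex_sub_one hex (invasion_mono U o hn hv) hC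

/-- Contrapositive, the form used for NTW's (f1) «`ω ∈ (𝓑_0^{m_i})^c` implies `z(ω) ∉ 𝓒_{p_c}(Γ_min(ω))`»: if `v ∈ I_{n_Λ}` has
`C_y(v) ⊆ Λ` and some vertex `w` `y`-joined to `v` is NOT invaded by the break-out time, contradiction — so a vertex set (e.g. the
vertices of `Γ_min`) containing a non-invaded vertex is not `y`-joined to `v`. [cite: NewmanTassionWu2017, §4.1 (f1) (p. 20)] -/
theorem not_reachable_of_not_mem_invasion_exitIndex {U : Sym2 V → ℝ} {o : V} {Λ : Finset V}
    (hex : ∃ n, ¬ invasion G U o n ⊆ Λ) {y : ℝ} {v w : V} (hv : v ∈ invasion G U o (exitIndex G U o Λ))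
    (hC : openCluster (configOfLabels y U G) v ⊆ ↑Λ) (hw : w ∉ invasion G U o (exitIndex G U o Λ)) :
    ¬ (openGraph (configOfLabels y U G)).Reachable v w := fun h =>
  hw (Finset.mem_coe.1 (openCluster_subset_invasion_exitIndex hex hv hC h))

end Summit.CriticalPhenomena.PercolationContinuityZ3.Theorems.Rsw3
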